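import Summits.NavierStokesRegularity.NavierStokesRegularity.Theses.AxisymmetricExtremality
import Literature.Analysis.FluidPDE.AxisymPoloidalCutoff
import Literature.Analysis.FluidPDE.Wei2016PoloidalCurl
import Literature.Analysis.FluidPDE.CollapseDebris
import Literature.Analysis.FluidPDE.BiotSavartNewtonKernel
import HarnessLib

/-!
# Seregin 2022, §2 Step 4: the first cut-off `div`–`curl` (elliptic) bound
# `‖∇(ζv̄)‖₂ ≤ c‖ζω_θ‖₂ + c‖|∇ζ||v̄|‖₂` — crux stmt-NavierStokesRegularity-15453 (`AxisymmetricExtremality.AxisymmetricKatoGlobal`), line registered, support for stub `stub_sereginLogSwirlOrigin`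

Support file (`--supports stmt-NavierStokesRegularity-15453`; theorems only, everything proved)
toward the registered stub `stub_sereginLogSwirlOrigin` = the named fact
`Literature.Analysis.FluidPDE.seregin2022_logSwirl_regularAtOrigin` (G. Seregin, J. Math. Fluid
Mech. 24 (2022), Paper 27 = arXiv:2201.00153, §2). Step 4 of that proof ("Final Conclusion",
arXiv p. 7) controls the poloidal part `v̄ = v_r e_r + v₃ e₃` of the axisymmetric solution through

> "the elliptic theory implies two classical bounds:
> `‖∇(η³v̄)‖_{2,𝒞} ≤ c‖ω_θη³‖_{2,𝒞} + c‖|∇η³||v̄|‖_{2,𝒞}` and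
> `‖∇²(η³v̄)‖_{2,𝒞} ≤ c‖|∇η³||∇v̄|‖_{2,𝒞} + c‖|∇²η³||v̄|‖_{2,𝒞} + c‖curl (ω_θη³e_θ)‖_{2,𝒞}`",

resting on `div v̄ = 0`, `curl v̄ = ω_θ e_θ` in `𝒞` and, with `ζ = η³` (Lemma 2.1, arXiv p. 5),
`div (ζv̄) = v̄·∇ζ`, `curl (ζv̄) = ζω_θe_θ + ∇ζ × v̄` in `ℝ³`. This file proves the FIRST bound,
for a general `C²` cut-off `ζ` with compact support and a general field `w` which is `C²` and
divergence free on an open set `U ⊇ tsupport ζ` only (at a fixed time the solution is smooth on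
the cylinder, not on `ℝ³`), with explicit constants and the Frobenius norm `|·|_F` of `D(ζw)`:

* `norm_curlCLM_smulRight_le_mul` — the sharp rank-one bound `‖curlCLM (ℓ ⊗ a)‖ ≤ ‖ℓ‖‖a‖`
  (`∇ζ × w`), and `contDiff_cutoff_smul` — `ζw ∈ Cⁿ(ℝ³)` from `w ∈ Cⁿ(U)`;
* `norm_curl_sq_add_divergence_sq_smul_le` — pointwise
  `‖curl (ζw)‖² + (div (ζw))² ≤ 2ζ²‖curl w‖² + 3‖Dζ‖²‖w‖²`;
* `lintegral_frobeniusNormSq_fderiv_smul_le` (registered sub-goal; hypothesis form `…_le'`) —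
  **`∫ |D(ζw)|²_F ≤ 2∫ ζ²‖curl w‖² + 3∫ ‖Dζ‖²‖w‖²`** in `[0, ∞]`, by the `div`–`curl` identity
  `∫ |DW|²_F = ∫ ‖curl W‖² + ∫ (div W)²` for the `C²_c` field `W = ζw` (accepted
  `integral_frobeniusNormSq_fderiv_eq_of_hasCompactSupport`, `AxisymPoloidalCutoff`);
* `lintegral_frobeniusNormSq_fderiv_smul_poloidal_le` — the axisymmetric specialisation with the
  tree's smooth poloidal field `b = u − (u_θ/r) J` (`angVelQuot`, `rotGen`; `= v̄`) of an
  axisymmetric `u ∈ C⁴(ℝ³)`, divergence free on `U`: `‖curl b‖² = r²Γ² = ω_θ²`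
  (`Wei2016.norm_curl_sub_angVelQuot_smul_rotGen_sq`, `Γ = angVortQuot u = ω_θ/r`), whence
  `∫ |D(ζb)|²_F ≤ 2∫ ζ² r²Γ² + 3∫ ‖Dζ‖²‖b‖²` — the printed bound with `c = √3`.

The second bound is the sibling file `…CutoffDivCurlSecondOrder.lean`.

## Mathlib / tree search

Tree: `integral_frobeniusNormSq_fderiv_eq_of_hasCompactSupport` and the off-axis poloidal
cut-off bound `integral_frobeniusNormSq_fderiv_smul_poloidalPart_le` (`AxisymPoloidalCutoff`;
needs `tsupport ψ` OFF the axis, so not applicable to Seregin's `η`, whose support meets the axis),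
`lintegral_frobeniusNormSq_fderiv_le_lintegral_sq_norm_curl` (div-free on all of `ℝ³`, `L²`),
`curl_smul`, `norm_curlCLM_smulRight_le` (constant `‖curlCLM‖`), `curlCLM_smulRight_innerSL`,
`norm_cross`, `divergence_smul_apply`, `measurable_curl`, `Wei2016.*_sub_angVelQuot_smul_rotGen*`.
`lean search 'frobeniusNormSq_fderiv_smul_le|norm_curlCLM_smulRight_le_mul'`: no matches
(2026-08-17).

## References

* G. Seregin, J. Math. Fluid Mech. 24 (2022), Paper No. 27 = arXiv:2201.00153, §2 Step 4 (arXiv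
  p. 7, the two "classical bounds") and Lemma 2.1 (arXiv p. 5, `div`/`curl` of `ζv̄`).
  [`Seregin2022LocalAxisym`]
-/

noncomputable section

open Set MeasureTheory Filter Topology Function
open scoped ENNReal RealInnerProductSpace
open Literature.Analysis.FluidPDE

-- `<Problem> = <Summit>` duplicates a namespace component by design (lakefile sets the same option).
set_option linter.dupNamespace false

namespace Summit.NavierStokesRegularity.NavierStokesRegularity.Theorems.AxisymmetricKatoGlobal.EulerScaling

/-! ### Pointwise algebra -/

/-- **Sharp rank-one bound for the curl**: `‖curlCLM (ℓ ⊗ a)‖ ≤ ‖ℓ‖ ‖a‖` — the curl of the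
rank-one Jacobian `h ↦ ℓ(h) a` is the cross product `ℓ♯ × a` (accepted
`curlCLM_smulRight_innerSL`, `norm_cross`). [folklore] -/
theorem norm_curlCLM_smulRight_le_mul (ℓ : EuclideanSpace ℝ (Fin 3) →L[ℝ] ℝ)
    (a : EuclideanSpace ℝ (Fin 3)) : ‖curlCLM (ℓ.smulRight a)‖ ≤ ‖ℓ‖ * ‖a‖ := by
  set g : EuclideanSpace ℝ (Fin 3) :=
    (InnerProductSpace.toDual ℝ (EuclideanSpace ℝ (Fin 3))).symm ℓ with hg
  have hℓ : ℓ = innerSL ℝ g := by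
    ext x
    rw [innerSL_apply_apply, hg, InnerProductSpace.toDual_symm_apply]
  rw [hℓ, curlCLM_smulRight_innerSL, norm_cross, innerSL_apply_norm]
  have h0 : 0 ≤ ‖g‖ * ‖a‖ := by positivity
  exact mul_le_of_le_one_right h0 (Real.sin_le_one _)

/-! ### The cut-off field `W = ζ w` -/

section Cutoff

variable {ζ : EuclideanSpace ℝ (Fin 3) → ℝ}
  {w : EuclideanSpace ℝ (Fin 3) → EuclideanSpace ℝ (Fin 3)} {U : Set (EuclideanSpace ℝ (Fin 3))}

/-- A function vanishing off a closed set `K` has vanishing derivative off `K` (the complement is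
open). [folklore] -/
theorem fderiv_eq_zero_of_forall_notMem {F : Type*} [NormedAddCommGroup F] [NormedSpace ℝ F]
    {K : Set (EuclideanSpace ℝ (Fin 3))} (hK : IsClosed K) {g : EuclideanSpace ℝ (Fin 3) → F}
    (hg : ∀ y ∉ K, g y = 0) {x : EuclideanSpace ℝ (Fin 3)} (hx : x ∉ K) : fderiv ℝ g x = 0 := by
  have h : g =ᶠ[𝓝 x] fun _ => (0 : F) := by
    filter_upwards [hK.isOpen_compl.mem_nhds hx] with y hy using hg y hy
  rw [h.fderiv_eq, fderiv_const_apply]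

/-- A continuous real function vanishing off a compact set is integrable. [folklore] -/
theorem integrable_of_continuous_of_forall_notMem {f : EuclideanSpace ℝ (Fin 3) → ℝ}
    {K : Set (EuclideanSpace ℝ (Fin 3))} (hK : IsCompact K) (hf : Continuous f)
    (h0 : ∀ x ∉ K, f x = 0) : Integrable f :=
  hf.integrable_of_hasCompactSupport (HasCompactSupport.intro hK h0)

/-- `ζ w = 0` off `tsupport ζ`. [folklore] -/
theorem smul_eq_zero_of_notMem {y : EuclideanSpace ℝ (Fin 3)} (hy : y ∉ tsupport ζ) :
    ζ y • w y = 0 := by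
  rw [image_eq_zero_of_notMem_tsupport hy, zero_smul]

/-- `y ∉ tsupport ζ ⇒ y ∉ tsupport (ζ w)`. [folklore] -/
theorem notMem_tsupport_smul {y : EuclideanSpace ℝ (Fin 3)} (hy : y ∉ tsupport ζ) :
    y ∉ tsupport fun x => ζ x • w x := fun h => hy (tsupport_smul_subset_left _ _ h)

/-- **`ζ w` is `Cⁿ` on all of `ℝ³`** when `ζ ∈ Cⁿ` and `w` is `Cⁿ` on an open set `U ⊇ tsupport ζ`
(no regularity of `w` off `U` is needed). [folklore] -/
theorem contDiff_cutoff_smul {n : ℕ∞} (hζ : ContDiff ℝ n ζ) (hU : IsOpen U)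
    (hζU : tsupport ζ ⊆ U) (hw : ContDiffOn ℝ n w U) : ContDiff ℝ n fun y => ζ y • w y := by
  rw [contDiff_iff_contDiffAt]
  intro y
  by_cases hy : y ∈ tsupport ζ
  · exact hζ.contDiffAt.smul (hw.contDiffAt (hU.mem_nhds (hζU hy)))
  · refine (contDiffAt_const (c := (0 : EuclideanSpace ℝ (Fin 3)))).congr_of_eventuallyEq ?_
    filter_upwards [(isClosed_tsupport ζ).isOpen_compl.mem_nhds hy] with x hx
    exact smul_eq_zero_of_notMem hx

/-! ### First order: `|curl (ζw)|² + (div (ζw))² ≤ 2 ζ²|curl w|² + 3 ‖Dζ‖²|w|²` and its integral -/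

/-- **Pointwise first-order bound.** If `w` is differentiable and divergence free on a set
`U ⊇ tsupport ζ` and `ζ ∈ C¹`, then everywhere
`‖curl (ζw)‖² + (div (ζw))² ≤ 2 ζ² ‖curl w‖² + 3 ‖Dζ‖² ‖w‖²`
(`div (ζw) = Dζ·w`, `curl (ζw) = ζ curl w + ∇ζ × w`; Seregin: "`div (ζv̄) = v̄·∇ζ`,
`curl (ζv̄) = ζω_θe_θ + ∇ζ × v̄`"). [cite: Seregin2022LocalAxisym, §2 Lemma 2.1 proof and Step 4 (arXiv:2201.00153 pp. 5, 7)] -/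
theorem norm_curl_sq_add_divergence_sq_smul_le (hζ : ContDiff ℝ 1 ζ) (hζU : tsupport ζ ⊆ U)
    (hw : ∀ y ∈ U, DifferentiableAt ℝ w y) (hdiv : ∀ y ∈ U, VectorCalculus.divergence w y = 0)
    (y : EuclideanSpace ℝ (Fin 3)) :
    ‖curl (fun x => ζ x • w x) y‖ ^ 2 + VectorCalculus.divergence (fun x => ζ x • w x) y ^ 2 ≤
      2 * (ζ y ^ 2 * ‖curl w y‖ ^ 2) + 3 * (‖fderiv ℝ ζ y‖ ^ 2 * ‖w y‖ ^ 2) := by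
  by_cases hy : y ∈ tsupport ζ
  · have hyU : y ∈ U := hζU hy
    have hζd : DifferentiableAt ℝ ζ y := (hζ.differentiable one_ne_zero) y
    have hwd : DifferentiableAt ℝ w y := hw y hyU
    have hc : ‖curl (fun x => ζ x • w x) y‖ ≤ |ζ y| * ‖curl w y‖ + ‖fderiv ℝ ζ y‖ * ‖w y‖ := by
      rw [curl_smul hζd hwd]
      refine (norm_add_le _ _).trans (add_le_add ?_ (norm_curlCLM_smulRight_le_mul _ _))
      rw [norm_smul, Real.norm_eq_abs]
    have hd : |VectorCalculus.divergence (fun x => ζ x • w x) y| ≤ ‖fderiv ℝ ζ y‖ * ‖w y‖ := by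
      rw [divergence_smul_apply hζd hwd, hdiv y hyU, mul_zero, zero_add, real_inner_comm,
        gradient, InnerProductSpace.toDual_symm_apply, ← Real.norm_eq_abs]
      exact (fderiv ℝ ζ y).le_opNorm (w y)
    set a : ℝ := |ζ y| * ‖curl w y‖ with ha
    set b : ℝ := ‖fderiv ℝ ζ y‖ * ‖w y‖ with hb
    have ha0 : 0 ≤ a := by positivity
    have hb0 : 0 ≤ b := by positivity
    have h1 : ‖curl (fun x => ζ x • w x) y‖ ^ 2 ≤ (a + b) ^ 2 :=
      pow_le_pow_left₀ (norm_nonneg _) hc 2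
    have h2 : VectorCalculus.divergence (fun x => ζ x • w x) y ^ 2 ≤ b ^ 2 := by
      rw [← sq_abs]
      exact pow_le_pow_left₀ (abs_nonneg _) hd 2
    have ea : a ^ 2 = ζ y ^ 2 * ‖curl w y‖ ^ 2 := by rw [ha, mul_pow, sq_abs]
    have eb : b ^ 2 = ‖fderiv ℝ ζ y‖ ^ 2 * ‖w y‖ ^ 2 := by rw [hb, mul_pow]
    nlinarith [sq_nonneg (a - b)]
  · rw [curl_eq_zero_of_notMem_tsupport (notMem_tsupport_smul hy),
      divergence_eq_zero_of_notMem_tsupport (notMem_tsupport_smul hy), norm_zero]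
    have h0 : (0 : ℝ) ^ 2 + 0 ^ 2 = 0 := by norm_num
    rw [h0]
    positivity

/-- **First-order cut-off `div`–`curl` bound** (hypothesis form). For `ζ ∈ C²_c(ℝ³)` and `w` of
class `C²` and divergence free on an open `U ⊇ tsupport ζ`,
`∫ |D(ζw)|²_F ≤ 2 ∫ ζ²‖curl w‖² + 3 ∫ ‖Dζ‖²‖w‖²` in `[0, ∞]` (the `div`–`curl` identity
`∫ |D(ζw)|²_F = ∫ ‖curl (ζw)‖² + ∫ (div (ζw))²` for the compactly supported `C²` field `ζw`,
accepted `integral_frobeniusNormSq_fderiv_eq_of_hasCompactSupport`, and the pointwise bound).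
[cite: Seregin2022LocalAxisym, §2 Step 4 (arXiv:2201.00153 p. 7), first elliptic bound] -/
theorem lintegral_frobeniusNormSq_fderiv_smul_le' (hζ : ContDiff ℝ 2 ζ) (hζc : HasCompactSupport ζ)
    (hU : IsOpen U) (hζU : tsupport ζ ⊆ U) (hw : ContDiffOn ℝ 2 w U)
    (hdiv : ∀ y ∈ U, VectorCalculus.divergence w y = 0) :
    ∫⁻ x, ENNReal.ofReal (frobeniusNormSq (fderiv ℝ (fun y => ζ y • w y) x)) ≤
      2 * (∫⁻ x, ENNReal.ofReal (ζ x ^ 2 * ‖curl w x‖ ^ 2)) +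
        3 * ∫⁻ x, ENNReal.ofReal (‖fderiv ℝ ζ x‖ ^ 2 * ‖w x‖ ^ 2) := by
  set W : EuclideanSpace ℝ (Fin 3) → EuclideanSpace ℝ (Fin 3) := fun y => ζ y • w y with hW
  have hW2 : ContDiff ℝ 2 W := contDiff_cutoff_smul hζ hU hζU hw
  have hW1 : ContDiff ℝ 1 W := hW2.of_le (by norm_num)
  have hWc : HasCompactSupport W := hζc.smul_right
  have key := integral_frobeniusNormSq_fderiv_eq_of_hasCompactSupport hW2 hWc
  -- integrability: continuous integrands vanishing off `tsupport W`
  have hD0 : ∀ x ∉ tsupport W, fderiv ℝ W x = 0 := fun x hx => fderiv_of_notMem_tsupport ℝ hx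
  have hiF : Integrable fun x => frobeniusNormSq (fderiv ℝ W x) :=
    (continuous_frobeniusNormSq_fderiv hW1 one_ne_zero).integrable_of_hasCompactSupport
      (HasCompactSupport.intro hWc.isCompact fun x hx => by rw [hD0 x hx, frobeniusNormSq_zero])
  have hic : Integrable fun x => ‖curl W x‖ ^ 2 := by
    refine ((continuous_curl hW1).norm.pow 2).integrable_of_hasCompactSupport
      (HasCompactSupport.intro hWc.isCompact fun x hx => ?_)
    show ‖curl W x‖ ^ 2 = 0
    rw [curl_eq_zero_of_notMem_tsupport hx, norm_zero]; ring
  have hid : Integrable fun x => VectorCalculus.divergence W x ^ 2 := by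
    refine ((continuous_divergence (hW1.continuous_fderiv one_ne_zero)).pow 2)
      |>.integrable_of_hasCompactSupport (HasCompactSupport.intro hWc.isCompact fun x hx => ?_)
    show VectorCalculus.divergence W x ^ 2 = 0
    rw [divergence_eq_zero_of_notMem_tsupport hx]; ring
  have hsum : Integrable fun x => ‖curl W x‖ ^ 2 + VectorCalculus.divergence W x ^ 2 := hic.add hid
  have e1 : ∫⁻ x, ENNReal.ofReal (frobeniusNormSq (fderiv ℝ W x)) =
      ∫⁻ x, ENNReal.ofReal (‖curl W x‖ ^ 2 + VectorCalculus.divergence W x ^ 2) := by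
    rw [← ofReal_integral_eq_lintegral_ofReal hiF (ae_of_all _ fun x => frobeniusNormSq_nonneg _),
      key, ← integral_add hic hid, ofReal_integral_eq_lintegral_ofReal hsum
        (ae_of_all _ fun x => add_nonneg (sq_nonneg _) (sq_nonneg _))]
  rw [e1]
  have hwd : ∀ y ∈ U, DifferentiableAt ℝ w y := fun y hy =>
    (hw.contDiffAt (hU.mem_nhds hy)).differentiableAt (by norm_num)
  have hpt := norm_curl_sq_add_divergence_sq_smul_le (hζ.of_le (by norm_num)) hζU hwd hdiv
  calc ∫⁻ x, ENNReal.ofReal (‖curl W x‖ ^ 2 + VectorCalculus.divergence W x ^ 2)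
      ≤ ∫⁻ x, ENNReal.ofReal (2 * (ζ x ^ 2 * ‖curl w x‖ ^ 2) +
          3 * (‖fderiv ℝ ζ x‖ ^ 2 * ‖w x‖ ^ 2)) :=
        lintegral_mono fun x => ENNReal.ofReal_le_ofReal (hpt x)
    _ = 2 * (∫⁻ x, ENNReal.ofReal (ζ x ^ 2 * ‖curl w x‖ ^ 2)) +
          3 * ∫⁻ x, ENNReal.ofReal (‖fderiv ℝ ζ x‖ ^ 2 * ‖w x‖ ^ 2) := by
        have h2 : ∀ x, ENNReal.ofReal (2 * (ζ x ^ 2 * ‖curl w x‖ ^ 2) +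
            3 * (‖fderiv ℝ ζ x‖ ^ 2 * ‖w x‖ ^ 2)) =
            2 * ENNReal.ofReal (ζ x ^ 2 * ‖curl w x‖ ^ 2) +
              3 * ENNReal.ofReal (‖fderiv ℝ ζ x‖ ^ 2 * ‖w x‖ ^ 2) := fun x => by
          rw [ENNReal.ofReal_add (by positivity) (by positivity), ENNReal.ofReal_mul zero_le_two,
            ENNReal.ofReal_mul zero_le_three, ENNReal.ofReal_ofNat, ENNReal.ofReal_ofNat]
        have hm : Measurable fun x => 2 * ENNReal.ofReal (ζ x ^ 2 * ‖curl w x‖ ^ 2) :=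
          (((hζ.continuous.pow 2).measurable.mul
            ((measurable_curl w).norm.pow_const 2)).ennreal_ofReal).const_mul _
        simp_rw [h2]
        rw [lintegral_add_left hm, lintegral_const_mul' _ _ (by norm_num),
          lintegral_const_mul' _ _ (by norm_num)]

/-- **First-order cut-off `div`–`curl` bound (Seregin 2022, §2 Step 4, first elliptic bound:
"`‖∇(η³v̄)‖_{2,𝒞} ≤ c‖ω_θη³‖_{2,𝒞} + c‖|∇η³||v̄|‖_{2,𝒞}`").** For every cut-off
`ζ ∈ C²_c(ℝ³)` and every field `w` of class `C²` and divergence free on an open set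
`U ⊇ tsupport ζ`:
`∫ |D(ζw)|²_F ≤ 2 ∫ ζ² ‖curl w‖² + 3 ∫ ‖Dζ‖² ‖w‖²` (lower Lebesgue integrals; with `ζ = η³`,
`w = v̄`, `curl v̄ = ω_θ e_θ` this is the printed bound, `c = √3`). Registered sub-goal toward
`stub_sereginLogSwirlOrigin`. [cite: Seregin2022LocalAxisym, §2 Step 4 (arXiv:2201.00153 p. 7), first elliptic bound] -/
theorem lintegral_frobeniusNormSq_fderiv_smul_le : ∀ (ζ : EuclideanSpace ℝ (Fin 3) → ℝ) (w : EuclideanSpace ℝ (Fin 3) → EuclideanSpace ℝ (Fin 3)) (U : Set (EuclideanSpace ℝ (Fin 3))), ContDiff ℝ 2 ζ → HasCompactSupport ζ → IsOpen U → tsupport ζ ⊆ U → ContDiffOn ℝ 2 w U → (∀ y ∈ U, VectorCalculus.divergence w y = 0) → ∫⁻ x, ENNReal.ofReal (frobeniusNormSq (fderiv ℝ (fun y => ζ y • w y) x)) ≤ 2 * (∫⁻ x, ENNReal.ofReal (ζ x ^ 2 * ‖curl w x‖ ^ 2)) + 3 * ∫⁻ x, ENNReal.ofReal (‖fderiv ℝ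 ζ x‖ ^ 2 * ‖w x‖ ^ 2) :=
  fun _ _ _ hζ hζc hU hζU hw hdiv => lintegral_frobeniusNormSq_fderiv_smul_le' hζ hζc hU hζU hw hdiv

/-- **The first elliptic bound for the poloidal part of an axisymmetric field.** Let `u ∈ C⁴(ℝ³)`
be axisymmetric and divergence free on an open `U ⊇ tsupport ζ`, `ζ ∈ C²_c`, and let
`b = u − (u_θ/r) J` be its (smooth) poloidal part `v̄ = u_r e_r + u₃ e₃` (`angVelQuot u = u_θ/r`,
`J = rotGen`). Then `∫ |D(ζb)|²_F ≤ 2 ∫ ζ² r²Γ² + 3 ∫ ‖Dζ‖² ‖b‖²` with `Γ = angVortQuot u = ω_θ/r`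
(`r²Γ² = ω_θ² = ‖curl b‖²`, `Wei2016.norm_curl_sub_angVelQuot_smul_rotGen_sq`; `div b = div u`).
[cite: Seregin2022LocalAxisym, §2 Step 4 (arXiv:2201.00153 p. 7), first elliptic bound] -/
theorem lintegral_frobeniusNormSq_fderiv_smul_poloidal_le
    {u : EuclideanSpace ℝ (Fin 3) → EuclideanSpace ℝ (Fin 3)} (hax : IsAxisymmetric u)
    (hu : ContDiff ℝ 4 u) (hζ : ContDiff ℝ 2 ζ) (hζc : HasCompactSupport ζ) (hU : IsOpen U)
    (hζU : tsupport ζ ⊆ U) (hdiv : ∀ y ∈ U, VectorCalculus.divergence u y = 0) :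
    ∫⁻ x, ENNReal.ofReal (frobeniusNormSq
        (fderiv ℝ (fun y => ζ y • (u y - angVelQuot u y • rotGen y)) x)) ≤
      2 * (∫⁻ x, ENNReal.ofReal (ζ x ^ 2 * ((x 0 ^ 2 + x 1 ^ 2) * angVortQuot u x ^ 2))) +
        3 * ∫⁻ x, ENNReal.ofReal
          (‖fderiv ℝ ζ x‖ ^ 2 * ‖u x - angVelQuot u x • rotGen x‖ ^ 2) := by
  have hJ : ContDiff ℝ 2 (rotGen : EuclideanSpace ℝ (Fin 3) → EuclideanSpace ℝ (Fin 3)) := by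
    rw [show (rotGen : EuclideanSpace ℝ (Fin 3) → EuclideanSpace ℝ (Fin 3)) = ⇑rotGenL from
      funext fun v => rfl]
    exact rotGenL.contDiff
  have hb : ContDiff ℝ 2 fun y => u y - angVelQuot u y • rotGen y :=
    (hu.of_le (by norm_num)).sub ((contDiff_angVelQuot (n := 2) hu).smul hJ)
  have hdivb : ∀ y ∈ U, VectorCalculus.divergence (fun x => u x - angVelQuot u x • rotGen x) y = 0 :=
    fun y hy => by
      rw [Wei2016.divergence_sub_angVelQuot_smul_rotGen hax (hu.of_le (by norm_num)) y]
      exact hdiv y hy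
  refine (lintegral_frobeniusNormSq_fderiv_smul_le' hζ hζc hU hζU hb.contDiffOn hdivb).trans
    (le_of_eq ?_)
  simp_rw [Wei2016.norm_curl_sub_angVelQuot_smul_rotGen_sq hax hu]

end Cutoff

end Summit.NavierStokesRegularity.NavierStokesRegularity.Theorems.AxisymmetricKatoGlobal.EulerScaling

end
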